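import Literature.AnabelianGeometry.EtaleTheta.SettingModelThm16iIndependence

/-!
# [EtTh] Theorem 1.6 (i): the universal closure of the named fact `ThetaSetting.Thm16i` is false as typed

Mochizuki, *The étale theta function and its Frobenioid-theoretic manifestations*, Publ. RIMS **45** (2009),
§1, Thm. 1.6 (i), PRIMS PDF p. 24 (printed p. 250): for an isomorphism of topological groups
`γ : Π^tp_{Xα} →̃ Π^tp_{Xβ}`, "We have: `γ(Π^tp_{Ÿα}) = Π^tp_{Ÿβ}`" [cite: MochizukiEtTh2009, Thm 1.6 (i) p.24].
abc-iut cell, block F (fact-proving wave), seat abc-iut-f-004, FROZEN FACT-LIST row **F-0585**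
(`Literature.AnabelianGeometry.EtaleTheta.ThetaSetting.Thm16i`, kernel_closedness = parametrised).

The row's declaration `ThetaSetting.Thm16i γ : Prop` (abc-iut-L2-t1, `TemperedRigidity.lean`) is a SCHEMA over two
arbitrary inhabitants `Dα Dβ` of the root interface `ThetaSetting p` and an arbitrary topological-group isomorphism
`γ`.  Its universal closure — the only 0-ary reading of the row — is FALSE in the kernel: abc-iut-L2-lead's
`SettingModel.exists_deltaPreserving_not_thm16i` (`SettingModelThm16iIndependence.lean`) exhibits, at the root NV
model `ThetaSetting.model p`, the generator-swap automorphism of the discrete `Π^tp_X = F₂ × G_{ℚ_p}`, which violates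
`Thm16i`.  This proof-only file records that witness in the three shapes the FACT-LIST renderer and the consumers
read: `exists_not_thm16i` (a setting and a self-isomorphism violating the row, at every prime `p`),
`not_forall_thm16i_at` (the closure over `Dα Dβ γ` at a fixed prime is false) and `not_forall_thm16i` (the full
universal closure over `p, Dα, Dβ, γ` is false).  CONSEQUENCE FOR CONSUMERS (R5 of plan/FACT-LIST.md): the row is
admissible AT NAMED INSTANCES ONLY — binding `(h16 : ThetaSetting.Thm16i γX)` for the specific `γX` at hand
(`Discharge/Sec1Prop18.lean`, `ConstantMultipleRigidity.lean`) stays sound, whereas a hypothesis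
`∀ Dα Dβ γ, Thm16i γ` would be unsatisfiable and make any theorem taking it vacuous; the instance form from the
printed inputs is abc-iut-L6-d5's `Thm16Sub.thm16i_of_inputs` / `thm16i_of_isKernelOfAction`
(`Thm16SubdagAssembly.lean`), whose residual inputs R1 (`KerToZIsCompactlyGenerated`) and the cusp of `X^log` are
certified load-bearing by the same toy (`SettingModel.thm16i_not_derivable`).

HONEST FRAMING: a statement about the TYPED root interface (any `ThetaSetting`), not about the tempered fundamental
group of an actual once-punctured elliptic curve, for which Thm. 1.6 (i) is a published theorem; typed ≠ proved;
no side is taken on [IUTchIII] Cor. 3.12.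
-/

namespace Literature.AnabelianGeometry.EtaleTheta.ThetaSetting

/-- **F-0585, instance-level counterexample.** At every prime `p` there are an inhabitant `D` of the root interface
`ThetaSetting p` (the NV model `ThetaSetting.model p`) and a topological-group automorphism `γ` of `Π^tp_X` with
`γ(Π^tp_Ÿ) ≠ Π^tp_Ÿ`, i.e. `¬ Thm16i γ` (the generator swap of abc-iut-L2-lead's
`SettingModel.exists_deltaPreserving_not_thm16i`). [cite: MochizukiEtTh2009, Thm 1.6 (i) p.24] -/
theorem exists_not_thm16i (p : ℕ) [Fact p.Prime] :
    ∃ (D : ThetaSetting p) (γ : D.PiTemp ≃ₜ* D.PiTemp),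
      ¬ Literature.AnabelianGeometry.EtaleTheta.ThetaSetting.Thm16i γ := by
  obtain ⟨γ, -, -, hγ⟩ := SettingModel.exists_deltaPreserving_not_thm16i p
  exact ⟨ThetaSetting.model p, γ, hγ⟩

/-- **F-0585, the closure at a fixed prime is false**: it is NOT the case that every topological-group isomorphism
`γ : Π^tp_{Xα} →̃ Π^tp_{Xβ}` between inhabitants of `ThetaSetting p` satisfies `γ(Π^tp_{Ÿα}) = Π^tp_{Ÿβ}`.
[cite: MochizukiEtTh2009, Thm 1.6 (i) p.24] -/
theorem not_forall_thm16i_at (p : ℕ) [Fact p.Prime] :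
    ¬ ∀ (Dα Dβ : ThetaSetting p) (γ : Dα.PiTemp ≃ₜ* Dβ.PiTemp),
        Literature.AnabelianGeometry.EtaleTheta.ThetaSetting.Thm16i γ := by
  intro H
  obtain ⟨D, γ, hγ⟩ := exists_not_thm16i p
  exact hγ (H D D γ)

/-- **F-0585, the universal closure of the row is false** (`¬ ∀ p Dα Dβ γ, Thm16i γ`): the FROZEN FACT-LIST row
`ThetaSetting.Thm16i` is admissible at named instances only (plan/FACT-LIST.md, R5), never as its universal
closure. [cite: MochizukiEtTh2009, Thm 1.6 (i) p.24] -/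
theorem not_forall_thm16i :
    ¬ ∀ (p : ℕ) [Fact p.Prime] (Dα Dβ : ThetaSetting p) (γ : Dα.PiTemp ≃ₜ* Dβ.PiTemp),
        Literature.AnabelianGeometry.EtaleTheta.ThetaSetting.Thm16i γ :=
  fun H => not_forall_thm16i_at 2 (H 2)

end Literature.AnabelianGeometry.EtaleTheta.ThetaSetting
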